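import Summits.ResolutionOfSingularities.ResolutionOfSingularities.Theorems.FrobeniusClosingPatchingRelPerfectDepthPhaseCCarrierGameLiftAmbient
import Summits.ResolutionOfSingularities.ResolutionOfSingularities.Theorems.FrobeniusClosingPatchingRelPerfectMonomialRouteKOrder
import Summits.ResolutionOfSingularities.ResolutionOfSingularities.Theorems.FrobeniusClosingPatchingRelPerfectDepthMultiHostFormatSnc
import Literature.AlgebraicGeometry.Resolution.RegularSubschemeLocallyIrreducible
import Literature.AlgebraicGeometry.Resolution.MarkedIdealsRestrict
import Literature.AlgebraicGeometry.Resolution.BlowupRestrictOpen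
import Literature.AlgebraicGeometry.Resolution.CanonicalResolutionSmoothCentre
import HarnessLib

/-!
# Crux `PatchingRelPerfect` (stmt-ResolutionOfSingularities-16161), chain W5.2 — F7(β) (β-AX) X3 C-I (G2) engine:
# (G-P) PERSISTENCE OF LOCAL END, part 1 (ROWS AND TRANSPORT): the local computation on a patch and its transport to `Bl_C X`

[OURS · L1 W5.2 · res-L1-w52-idea-1 Sketch v19 §4.5 (G-P) `X3LemmaM.EndStratumStep` 8ba1c33b3f45dd7b l.413–428, RULINGS G12-27/G12-29/
G12-32 → res-D-pv-046 ((G2) engine hand)] Replaces the role of NO printed item; NOT a statement of the manuscript under review; fact-free; any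
dimension. `IsEndNear` / `IsEndPresentation` / `singGE` are res-L1-w52-idea-1's sketch definitions, not yet in the tree: this file proves
(G-P) with those predicates UNFOLDED (a three-line wrapper gives the literal Prop once the definitions land).

LOCAL END of `K` at `x` with letters from a global list `𝓛`: on some open `U ∋ x`, for a sub-list `Λ ⊆ 𝓛` restricting to an snc family
on `U` and exponent rows `𝒦 ≠ []` on `Λ`, `K|_U = (Σ_{A ∈ 𝒦} Λ^A)|_U`.

* `strictTransformIdeal_top`, `controlledTransform_top` — along a blow-up whose centre ideal is the unit ideal both transforms are pull-backs.
* `comap_map_strictTransformIdeal` — strict transforms of letters restrict along the open embedding `Bl_{C|_U} U ↪ Bl_C X`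
  (`MarkedIdeal.transform_comap_of_isOpenImmersion` read on the boundary).
* `exists_rows_offCentre` / **`exists_rows_onCentre`** — on the patch `U`, the marked controlled transform of the monomial sum is again a
  monomial sum in the transformed letters `Λ|_U.map st ++ [E]` with explicit exceptional exponents (`0` off the centre; `weightAt L η − m`
  at the generic point `η` of the irreducible piece `V(C) ∩ U`, via the tree's `controlledTransform_monomialSum_of_isGenericPoint`, the
  weights `≥ m` being read off `V(C) ⊆ Sing(K, m)` by `mem_support_monomialSum_marked_iff`).
* `isEndNear_transform_of_rows` — transport to `Bl_C X` along the cartesian square `blowup.map C U.ι` (GW 13.91 (2)).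
* part 2 (`…LocalGamePersistence`): **`endStratumStep`** — (G-P) itself.

AI-written; AI review is weaker than expert review.

## References (for the mathematics; nothing here is a statement of the manuscript under review)
* J. Kollár, *Lectures on Resolution of Singularities* (2007), (3.111) Step 3, Def. 3.65. [Kollar2007]
* E. Bierstone, D. Grigoriev, P. Milman, J. Włodarczyk, arXiv:1206.3090, Def. 3.1.3, Lemma 3.2.1, §4 Step 2b. [BierstoneGrigorievMilmanWlodarczyk2011]
* U. Görtz, T. Wedhorn, *Algebraic Geometry I* (2nd ed. 2020), Prop. 13.91. [GortzWedhorn2020]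
-/

-- `Summit.<Summit>.<Sub>.Theorems` with `Sub = Summit` (single-conjunct summit, D-0017)
set_option linter.dupNamespace false

noncomputable section

open CategoryTheory AlgebraicGeometry TopologicalSpace IsLocalRing
open Literature.AlgebraicGeometry.Resolution
open Scheme.IdealSheafData (vanishingIdeal)

namespace Summit.ResolutionOfSingularities.ResolutionOfSingularities.Theorems

namespace X3LemmaM

open DepthTargets (monomialSum monomialSum_nil monomialSum_cons)
open DepthMultiHost (comap_monomialSum_map boundaryOf_map_comap)

universe u

variable {X X' : Scheme.{u}}

/-! ## §1 Transforms along a blow-up with unit centre ideal -/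

/-- Along a blow-up whose centre ideal is `⊤`, the strict transform is the pull-back. [folklore] -/
theorem strictTransformIdeal_top (π : X' ⟶ X) (F : X.IdealSheafData) :
    strictTransformIdeal π ⊤ F = F.comap π := by
  rw [strictTransformIdeal, Scheme.IdealSheafData.comap_top]
  have h : ∀ n : ℕ, colon (F.comap π) ((⊤ : X'.IdealSheafData) ^ n) = F.comap π := fun n => by
    rw [← Scheme.IdealSheafData.one_eq_top, one_pow, Scheme.IdealSheafData.one_eq_top, colon_top]
  simp only [h, iSup_const]

/-- Along a blow-up whose centre ideal is `⊤`, the controlled transform is the pull-back. [folklore] -/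
theorem controlledTransform_top (π : X' ⟶ X) (F : X.IdealSheafData) (m : ℕ) :
    controlledTransform π ⊤ F m = F.comap π := by
  rw [controlledTransform, Scheme.IdealSheafData.comap_top, ← Scheme.IdealSheafData.one_eq_top, one_pow,
    Scheme.IdealSheafData.one_eq_top, colon_top]

/-! ## §2 Letters restrict along the open embedding of blow-ups -/

section Square

variable [IsLocallyNoetherian X] (C : X.IdealSheafData) (U : X.Opens)

/-- **Strict transforms of letters restrict along `Bl_{C|_U} U ↪ Bl_C X`**: `st_π(F)|_{Bl U} = st_{π_U}(F|_U)` (read off the boundary of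
`MarkedIdeal.transform_comap_of_isOpenImmersion` for the marked ideal `(⊤, [F], 0)`). [cite: GortzWedhorn2020, Prop. 13.91 (2)]
[cite: BierstoneGrigorievMilmanWlodarczyk2011, Def. 3.1.3 (4) with Def. 3.1.5 Remark (1)] -/
theorem comap_map_strictTransformIdeal (F : X.IdealSheafData) :
    (strictTransformIdeal (blowup.π C) C F).comap (blowup.map C U.ι) =
      strictTransformIdeal (blowup.π (C.comap U.ι)) (C.comap U.ι) (F.comap U.ι) := by
  haveI : IsLocallyNoetherian (blowup C) := CentreSeq.isLocallyNoetherian_blowup C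
  haveI : IsLocallyNoetherian (blowup (C.comap U.ι)) := CentreSeq.isLocallyNoetherian_blowup _
  have h := MarkedIdeal.transform_comap_of_isOpenImmersion U.ι (blowup.map C U.ι) (blowup.map_π C U.ι) C
    (⟨⊤, [F], 0⟩ : MarkedIdeal X)
  have hb := congrArg MarkedIdeal.boundary h
  simp only [MarkedIdeal.comap_boundary, MarkedIdeal.transform_boundary, List.map_cons, List.map_nil,
    List.cons_append, List.nil_append] at hb
  exact (List.cons.inj hb).1

omit [IsLocallyNoetherian X] in
/-- The exceptional ideal restricts: `(C·𝒪_{Bl X})|_{Bl U} = (C|_U)·𝒪_{Bl U}`. [folklore] -/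
theorem comap_map_comap_π :
    (C.comap (blowup.π C)).comap (blowup.map C U.ι) = (C.comap U.ι).comap (blowup.π (C.comap U.ι)) := by
  rw [← Scheme.IdealSheafData.comap_comp, blowup.map_π, Scheme.IdealSheafData.comap_comp]

/-- The controlled transform restricts: `(π^*K : (C·𝒪)^m)|_{Bl U} = (π_U^*(K|_U) : ((C|_U)·𝒪)^m)`. [cite: GortzWedhorn2020, Prop. 13.91 (2)]
[cite: BierstoneGrigorievMilmanWlodarczyk2011, Def. 3.1.3 (3) with Def. 3.1.5 Remark (1)] -/
theorem comap_map_controlledTransform (K : X.IdealSheafData) (m : ℕ) :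
    (controlledTransform (blowup.π C) C K m).comap (blowup.map C U.ι) =
      controlledTransform (blowup.π (C.comap U.ι)) (C.comap U.ι) (K.comap U.ι) m := by
  haveI : IsLocallyNoetherian (blowup C) := CentreSeq.isLocallyNoetherian_blowup C
  haveI : IsLocallyNoetherian (blowup (C.comap U.ι)) := CentreSeq.isLocallyNoetherian_blowup _
  have h := MarkedIdeal.transform_comap_of_isOpenImmersion U.ι (blowup.map C U.ι) (blowup.map_π C U.ι) C
    (⟨K, [], m⟩ : MarkedIdeal X)
  have hi := congrArg MarkedIdeal.ideal h
  simpa only [MarkedIdeal.comap_ideal, MarkedIdeal.transform_ideal, MarkedIdeal.comap_mult] using hi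

/-- The rows transported to `Bl_C X` — strict transforms of the letters and the exceptional letter with exponent `e L` per row —
restrict along `Bl_{C|_U} U ↪ Bl_C X` to the transformed restricted rows. [folklore] -/
theorem map_rows_comap_map (𝒦 : List (List (X.IdealSheafData × ℕ))) (e : List (X.IdealSheafData × ℕ) → ℕ) :
    (𝒦.map fun L => (L.map fun p => (strictTransformIdeal (blowup.π C) C p.1, p.2)) ++ [(C.comap (blowup.π C), e L)]).map
        (fun A => A.map fun p => (p.1.comap (blowup.map C U.ι), p.2)) =
      𝒦.map fun L => ((L.map fun p => (p.1.comap U.ι, p.2)).map fun p =>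
          (strictTransformIdeal (blowup.π (C.comap U.ι)) (C.comap U.ι) p.1, p.2)) ++
        [((C.comap U.ι).comap (blowup.π (C.comap U.ι)), e L)] := by
  rw [List.map_map]
  refine List.map_congr_left fun L _ => ?_
  simp only [Function.comp_apply, Function.comp_def, List.map_append, List.map_map, List.map_cons, List.map_nil,
    comap_map_strictTransformIdeal, comap_map_comap_π]

end Square

/-! ## §3 Transport of a local presentation to `Bl_C X` -/

section Transport

variable [IsLocallyNoetherian X] (C K : X.IdealSheafData) (m : ℕ) (𝓛 : List X.IdealSheafData)

/-- **Transport to `Bl_C X`.** If, on the blow-up of the patch `U` along `C|_U`, the controlled transform of `K|_U` is the monomial sum of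
the transformed restricted rows (strict transforms of the letters, the exceptional letter with exponent `e L` per row) over an snc letter
family, then `K₁ = (π^*K : (C·𝒪)^m)` is locally END at every point of `Bl_C X` over `U`, with letters the strict transforms `𝓛.map st`
and the exceptional ideal `C·𝒪` (cartesian square `Bl_{C|_U} U = Bl_C X ×_X U`, GW 13.91 (2)). [cite: GortzWedhorn2020, Prop. 13.91 (2)]
[cite: BierstoneGrigorievMilmanWlodarczyk2011, Def. 3.1.3 (3)–(5)] -/
theorem isEndNear_transform_of_rows {Λ : List X.IdealSheafData} (hΛ : ∀ F ∈ Λ, F ∈ 𝓛) (U : X.Opens)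
    {𝒦 : List (List (X.IdealSheafData × ℕ))} (hbd : ∀ L ∈ 𝒦, boundaryOf L = Λ) (hne : 𝒦 ≠ [])
    (e : List (X.IdealSheafData × ℕ) → ℕ)
    (hct : controlledTransform (blowup.π (C.comap U.ι)) (C.comap U.ι) (K.comap U.ι) m =
      monomialSum (𝒦.map fun L => ((L.map fun p => (p.1.comap U.ι, p.2)).map fun p =>
          (strictTransformIdeal (blowup.π (C.comap U.ι)) (C.comap U.ι) p.1, p.2)) ++
        [((C.comap U.ι).comap (blowup.π (C.comap U.ι)), e L)]))
    (hsnc : HasSNC ((Λ.map fun F => F.comap U.ι).map (strictTransformIdeal (blowup.π (C.comap U.ι)) (C.comap U.ι)) ++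
        [(C.comap U.ι).comap (blowup.π (C.comap U.ι))]))
    (x' : blowup C) (hx' : blowup.π C x' ∈ (U : Set X)) :
    ∃ Λ₁ : List (blowup C).IdealSheafData,
      (∀ F ∈ Λ₁, F ∈ 𝓛.map (strictTransformIdeal (blowup.π C) C) ++ [C.comap (blowup.π C)]) ∧
      ∃ U₁ : (blowup C).Opens, x' ∈ (U₁ : Set (blowup C)) ∧ HasSNC (Λ₁.map fun F => F.comap U₁.ι) ∧
        ∃ 𝒦₁ : List (List ((blowup C).IdealSheafData × ℕ)), (∀ L ∈ 𝒦₁, boundaryOf L = Λ₁) ∧ 𝒦₁ ≠ [] ∧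
          (controlledTransform (blowup.π C) C K m).comap U₁.ι = (monomialSum 𝒦₁).comap U₁.ι := by
  haveI : IsLocallyNoetherian (blowup C) := CentreSeq.isLocallyNoetherian_blowup C
  haveI : IsLocallyNoetherian (blowup (C.comap U.ι)) := CentreSeq.isLocallyNoetherian_blowup _
  set π := blowup.π C with hπ
  set g := blowup.map C U.ι with hg
  set Λ₁ : List (blowup C).IdealSheafData := Λ.map (strictTransformIdeal π C) ++ [C.comap π] with hΛ₁
  set 𝒦₁ : List (List ((blowup C).IdealSheafData × ℕ)) :=
    𝒦.map fun L => (L.map fun p => (strictTransformIdeal π C p.1, p.2)) ++ [(C.comap π, e L)] with h𝒦₁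
  -- the identities along `g`
  have hK₁g : (controlledTransform π C K m).comap g = (monomialSum 𝒦₁).comap g := by
    rw [hπ, hg, comap_map_controlledTransform, hct, comap_monomialSum_map, h𝒦₁, map_rows_comap_map]
  have hΛ₁g : Λ₁.map (fun F => F.comap g) =
      (Λ.map fun F => F.comap U.ι).map (strictTransformIdeal (blowup.π (C.comap U.ι)) (C.comap U.ι)) ++
        [(C.comap U.ι).comap (blowup.π (C.comap U.ι))] := by
    simp only [hΛ₁, hπ, hg, List.map_append, List.map_map, List.map_cons, List.map_nil, Function.comp_def,
      comap_map_strictTransformIdeal, comap_map_comap_π]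
  -- the open `U₁ = g(Bl U)` and the isomorphism `Bl U ≅ U₁`
  let e₁ := g.isoOpensRange
  have hrange : x' ∈ (g.opensRange : Set (blowup C)) := by
    change x' ∈ Set.range g
    rw [hg, blowup.range_map, Scheme.Opens.range_ι]
    exact hx'
  have hιe : e₁.inv ≫ g = g.opensRange.ι := g.isoOpensRange_inv_comp
  have hcomap : ∀ F : (blowup C).IdealSheafData, F.comap g.opensRange.ι = (F.comap g).comap e₁.inv := fun F => by
    rw [← Scheme.IdealSheafData.comap_comp, hιe]
  refine ⟨Λ₁, fun F hF => ?_, g.opensRange, hrange, ?_, 𝒦₁, fun L hL => ?_, ?_, ?_⟩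
  · -- letters of `Λ₁` are among `𝓛.map st ++ [E]`
    rcases List.mem_append.mp hF with h | h
    · obtain ⟨F₀, hF₀, rfl⟩ := List.mem_map.mp h
      exact List.mem_append_left _ (List.mem_map.mpr ⟨F₀, hΛ F₀ hF₀, rfl⟩)
    · exact List.mem_append_right _ h
  · -- snc on `U₁`, transported along `e₁.inv`
    have h1 : Λ₁.map (fun F => F.comap g.opensRange.ι) = (Λ₁.map fun F => F.comap g).map fun F => F.comap e₁.inv := by
      rw [List.map_map]
      exact List.map_congr_left fun F _ => hcomap F
    rw [h1, hΛ₁g]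
    have h2 := hsnc.comap_of_isOpenImmersion e₁.inv
    rwa [Scheme.IdealSheafData.comap_top] at h2
  · obtain ⟨L₀, hL₀, rfl⟩ := List.mem_map.mp hL
    rw [DepthTargets.boundaryOf_map_strictTransform_append, hbd L₀ hL₀]
  · exact fun h => hne (List.map_eq_nil_iff.mp h)
  · rw [hcomap, hcomap, hK₁g]

end Transport

/-! ## §4 The rows off the centre -/

section OffCentre

variable {Y Y' : Scheme.{u}}

/-- Dropping the trailing exceptional letter with exponent `0` does not change the monomial sum of the transformed rows. [folklore] -/
theorem monomialSum_rows_zero (π' : Y' ⟶ Y) (D : Y.IdealSheafData) (𝒦U : List (List (Y.IdealSheafData × ℕ))) :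
    monomialSum (𝒦U.map fun L => (L.map fun p => (strictTransformIdeal π' D p.1, p.2)) ++ [(D.comap π', 0)]) =
      monomialSum (𝒦U.map fun L => L.map fun p => (strictTransformIdeal π' D p.1, p.2)) := by
  induction 𝒦U with
  | nil => rfl
  | cons L 𝒦U ih =>
    rw [List.map_cons, List.map_cons, monomialSum_cons, monomialSum_cons, ih, monomialIdeal_append,
      monomialIdeal_singleton, pow_zero, Scheme.IdealSheafData.one_eq_top, Scheme.IdealSheafData.mul_top]

/-- Along a blow-up whose centre ideal is the unit ideal the controlled transform is the pull-back (centre as a variable). [folklore] -/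
theorem controlledTransform_eq_comap_of_eq_top (π' : Y' ⟶ Y) {D : Y.IdealSheafData} (hD : D = ⊤) (I : Y.IdealSheafData) (m : ℕ) :
    controlledTransform π' D I m = I.comap π' := by
  subst hD; exact controlledTransform_top π' I m

/-- Along a blow-up whose centre ideal is the unit ideal the strict transform is the pull-back (centre as a variable). [folklore] -/
theorem strictTransformIdeal_eq_comap_of_eq_top (π' : Y' ⟶ Y) {D : Y.IdealSheafData} (hD : D = ⊤) (F : Y.IdealSheafData) :
    strictTransformIdeal π' D F = F.comap π' := by
  subst hD; exact strictTransformIdeal_top π' F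

end OffCentre

section OffCentreRows

variable [IsLocallyNoetherian X] (C K : X.IdealSheafData) (m : ℕ)

omit [IsLocallyNoetherian X] in
/-- **The rows OFF the centre**: on a patch `U` missing `V(C)` (`C|_U = ⊤`) the controlled transform of `K|_U = (Σ 𝒦)|_U` is the
pull-back, i.e. the monomial sum of the transformed rows with exceptional exponent `0`. [folklore] -/
theorem controlledTransform_eq_rows_offCentre (U : X.Opens) (hCU : C.comap U.ι = ⊤)
    {𝒦 : List (List (X.IdealSheafData × ℕ))} (hKU : K.comap U.ι = (monomialSum 𝒦).comap U.ι) :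
    controlledTransform (blowup.π (C.comap U.ι)) (C.comap U.ι) (K.comap U.ι) m =
      monomialSum (𝒦.map fun L => ((L.map fun p => (p.1.comap U.ι, p.2)).map fun p =>
          (strictTransformIdeal (blowup.π (C.comap U.ι)) (C.comap U.ι) p.1, p.2)) ++
        [((C.comap U.ι).comap (blowup.π (C.comap U.ι)), 0)]) := by
  have hrows : (𝒦.map fun L => ((L.map fun p => (p.1.comap U.ι, p.2)).map fun p =>
          (strictTransformIdeal (blowup.π (C.comap U.ι)) (C.comap U.ι) p.1, p.2)) ++
        [((C.comap U.ι).comap (blowup.π (C.comap U.ι)), 0)]) =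
      (𝒦.map fun L => L.map fun p => (p.1.comap U.ι, p.2)).map fun L =>
        (L.map fun p => (strictTransformIdeal (blowup.π (C.comap U.ι)) (C.comap U.ι) p.1, p.2)) ++
          [((C.comap U.ι).comap (blowup.π (C.comap U.ι)), 0)] := by
    rw [List.map_map]; rfl
  rw [hrows, monomialSum_rows_zero, controlledTransform_eq_comap_of_eq_top _ hCU, hKU, comap_monomialSum_map,
    comap_monomialSum_map, List.map_map, List.map_map]
  congr 1
  refine List.map_congr_left fun L _ => ?_
  simp only [Function.comp_apply, List.map_map, Function.comp_def, strictTransformIdeal_eq_comap_of_eq_top _ hCU]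

/-- The letter family OFF the centre: transformed along a blow-up with unit centre it stays snc. [cite: Kollar2007, Def. 3.25] -/
theorem hasSNC_rows_offCentre (U : X.Opens) (hCU : C.comap U.ι = ⊤) {Λ : List X.IdealSheafData}
    (hsnc : HasSNC (Λ.map fun F => F.comap U.ι)) :
    HasSNC ((Λ.map fun F => F.comap U.ι).map (strictTransformIdeal (blowup.π (C.comap U.ι)) (C.comap U.ι)) ++
        [(C.comap U.ι).comap (blowup.π (C.comap U.ι))]) := by
  have h : HasSNCWith (Λ.map fun F => F.comap U.ι) (C.comap U.ι) := by rw [hCU]; exact hsnc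
  exact h.hasSNC_transform (blowup.isBlowup _)

end OffCentreRows

/-! ## §5 The rows at the centre -/

section OnCentreRows

variable [IsLocallyNoetherian X] (C K : X.IdealSheafData) (m : ℕ)

/-- **The rows AT the centre** (the tree's engine `controlledTransform_monomialSum_of_isGenericPoint` on the patch): on a patch `U` on
which the centre `C|_U` is regular with IRREDUCIBLE support, snc with the restricted letters, `K|_U = (Σ 𝒦)|_U`, and `V(C) ⊆ Sing(K, m)`,
the marked controlled transform of `K|_U` is the monomial sum of the transformed rows with exceptional exponent `weightAt L η − m`,
`η` the generic point of `V(C|_U)` (where every row has weight `≥ m`). [cite: Kollar2007, (3.111) Step 3]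
[cite: BierstoneGrigorievMilmanWlodarczyk2011, Lemma 3.2.1, §4 Step 2b] -/
theorem controlledTransform_eq_rows_onCentre (U : X.Opens) (hCregU : Scheme.IsRegular (C.comap U.ι).subscheme)
    (hirr : IsIrreducible (((C.comap U.ι).support : Set (U : Scheme.{u}))))
    {Λ : List X.IdealSheafData} (hsnc : HasSNC (Λ.map fun F => F.comap U.ι))
    (hsncD : HasSNCWith (Λ.map fun F => F.comap U.ι) (C.comap U.ι))
    {𝒦 : List (List (X.IdealSheafData × ℕ))} (hbd : ∀ L ∈ 𝒦, boundaryOf L = Λ)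
    (hKU : K.comap U.ι = (monomialSum 𝒦).comap U.ι)
    (hCsing : (C.support : Set X) ⊆ (⟨K, [], m⟩ : MarkedIdeal X).support) :
    controlledTransform (blowup.π (C.comap U.ι)) (C.comap U.ι) (K.comap U.ι) m =
      monomialSum (𝒦.map fun L => ((L.map fun p => (p.1.comap U.ι, p.2)).map fun p =>
          (strictTransformIdeal (blowup.π (C.comap U.ι)) (C.comap U.ι) p.1, p.2)) ++
        [((C.comap U.ι).comap (blowup.π (C.comap U.ι)), weightAt (L.map fun p => (p.1.comap U.ι, p.2)) hirr.genericPoint - m)]) := by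
  set D := C.comap U.ι with hD
  set W : Closeds (U : Scheme.{u}) := D.support with hW
  set η := hirr.genericPoint with hη
  have hηW : IsGenericPoint η (W : Set (U : Scheme.{u})) := hirr.isGenericPoint_genericPoint W.isClosed
  have hDW : D = vanishingIdeal W := eq_vanishingIdeal_support_of_isRegular D hCregU
  set 𝒦U : List (List ((U : Scheme.{u}).IdealSheafData × ℕ)) := 𝒦.map fun L => L.map fun p => (p.1.comap U.ι, p.2) with h𝒦U
  have hbdU : ∀ L ∈ 𝒦U, boundaryOf L = Λ.map fun F => F.comap U.ι := by
    intro L hL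
    obtain ⟨L₀, hL₀, rfl⟩ := List.mem_map.mp hL
    rw [boundaryOf_map_comap, hbd L₀ hL₀]
  have hKU' : K.comap U.ι = monomialSum 𝒦U := by rw [hKU, comap_monomialSum_map]
  -- weights `≥ m` at the generic point: `η ∈ V(C|_U)` lies over `V(C) ⊆ Sing(K, m)`
  have hν : ∀ L ∈ 𝒦U, m ≤ weightAt L η := by
    have hηD : η ∈ (W : Set (U : Scheme.{u})) := hηW.mem
    have hηs : U.ι η ∈ (⟨K, [], m⟩ : MarkedIdeal X).support := by
      apply hCsing
      have : η ∈ ((C.comap U.ι).support : Set (U : Scheme.{u})) := hηD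
      rw [Scheme.IdealSheafData.support_comap] at this
      exact this
    have hηs' : η ∈ (⟨monomialSum 𝒦U, [], m⟩ : MarkedIdeal (U : Scheme.{u})).support := by
      rw [← hKU']
      have h := MarkedIdeal.support_comap_of_isOpenImmersion U.ι (⟨K, [], m⟩ : MarkedIdeal X)
      have h' : η ∈ ((⟨K, [], m⟩ : MarkedIdeal X).comap U.ι).support := by rw [h]; exact hηs
      exact h'
    exact (PolyhedraGame.RouteK.mem_support_monomialSum_marked_iff 𝒦U (fun A hA => by rw [hbdU A hA]; exact hsnc) [] m η).mp hηs'
  -- the engine on the patch, centre `vanishingIdeal W = C|_U`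
  have hsncW : HasSNCWith (Λ.map fun F => F.comap U.ι) (vanishingIdeal W) := hDW ▸ hsncD
  have hτ : IsBlowup (blowup.π D) (vanishingIdeal W) := hDW ▸ blowup.isBlowup D
  have key := DepthMultiHost.controlledTransform_monomialSum_of_isGenericPoint (τ := blowup.π D) (ν := m) hηW hbdU hsncW hτ hν
  rw [← hDW] at key
  rw [hKU', key, h𝒦U, List.map_map]
  rfl

end OnCentreRows

end X3LemmaM

end Summit.ResolutionOfSingularities.ResolutionOfSingularities.Theorems

end
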